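import Literature.NumberTheory.Irrationality.KrattenthalerZudilin2019.EqEightWellPoisedRecurrenceProofs
import Literature.NumberTheory.Irrationality.KrattenthalerZudilin2019.EqEightHypergeometricSideProofs
import Literature.NumberTheory.Irrationality.KrattenthalerZudilin2019.RFourHypergeometricInstancesProofs
import HarnessLib

/-!
# Krattenthaler–Zudilin 2019, §4 eq. (8) — PROVED for every `n` (the named fact `rFour_eq_hypergeometric`)

Proofs-only file 6 (last) of the eq. (8) chain. [KrattenthalerZudilin2019, §4 eq. (8)]: for every `n`,
`r_n = Σ_{t≥1} R_n(t) = π²(2n)!⁴/(4n+1)!²·₃F₂(2n+1, 2n+1, 2n+1; 4n+2, 4n+2; 1)` — in print the case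
`a = b = c = 2n+1` of the authors' Theorem 4 (three non-terminating ₇F₆ transformations). HERE: both sides
satisfy the same second-order recurrence `P₂(n)u_{n+2} + P₁(n)u_{n+1} + P₀(n)u_n = 0` —
`EqEight.rFour_rec` (the well-poised side, by the creative-telescoping certificate of
`EqEightCertificate.lean`, kernel-verified in `EqEightCertificatePointsProofs.lean`) and `EqEight.rFourHyp_rec`
(the ₃F₂ side = π²× Apéry's `ζ(2)` forms, by Apéry's recurrence, `EqEightHypergeometricSideProofs.lean`) —
with `P₂(n) = (2n+3)²(2n+4)²(44n²+66n+25) > 0`, and they agree at `n = 0, 1`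
(`rFour_eq_rFourHyp_zero`, `rFour_eq_rFourHyp_one` of `RFourHypergeometricInstancesProofs.lean`, cell seat
gen-2); a two-term induction finishes. The leading terms `704u_{n+2} − 86592u_{n+1} + 704u_n` give the printed
characteristic polynomial `λ² − 123λ + 1`.
HONEST FRAMING (cell pub-zeta5, certifier seat cert-1): systematic search; an identity between explicitly given
`π²/π⁴` linear forms (special-function bookkeeping); nothing here concerns `ζ(5)`, no irrationality content.
Theorems only; statement files untouched.
-/

open Finset

namespace Literature.NumberTheory.Irrationality.KrattenthalerZudilin2019

/-- **Krattenthaler–Zudilin 2019, §4 eq. (8) — PROVED** (discharges the named fact `rFour_eq_hypergeometric`):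
for every `n`, `r_n = π²(2n)!⁴/(4n+1)!² · ₃F₂(2n+1, 2n+1, 2n+1; 4n+2, 4n+2; 1)`. Both sides satisfy the
recurrence `P₂(n)u_{n+2} + P₁(n)u_{n+1} + P₀(n)u_n = 0` (`EqEight.rFour_rec`, `EqEight.rFourHyp_rec`) with
`P₂(n) > 0`, and agree at `n = 0, 1`. [cite: KrattenthalerZudilin2019, §4 eq. (8) and Theorem 4] -/
theorem rFour_eq_hypergeometric_holds : rFour_eq_hypergeometric := by
  unfold rFour_eq_hypergeometric
  suffices h : ∀ n : ℕ, rFour n = rFourHyp n ∧ rFour (n + 1) = rFourHyp (n + 1) from fun n => (h n).1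
  intro n
  induction n with
  | zero => exact ⟨rFour_eq_rFourHyp_zero, rFour_eq_rFourHyp_one⟩
  | succ n ih =>
    refine ⟨ih.2, ?_⟩
    rw [show n + 1 + 1 = n + 2 from rfl]
    have h1 := EqEight.rFour_rec n
    have h2 := EqEight.rFourHyp_rec n
    have hP : (3600 + 17904 * (n : ℝ) + 35812 * (n : ℝ) ^ 2 + 36856 * (n : ℝ) ^ 3 + 20640 * (n : ℝ) ^ 4
        + 5984 * (n : ℝ) ^ 5 + 704 * (n : ℝ) ^ 6) ≠ 0 := by positivity
    rw [ih.1, ih.2] at h1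
    have h3 : (3600 + 17904 * (n : ℝ) + 35812 * (n : ℝ) ^ 2 + 36856 * (n : ℝ) ^ 3 + 20640 * (n : ℝ) ^ 4
        + 5984 * (n : ℝ) ^ 5 + 704 * (n : ℝ) ^ 6) * (rFour (n + 2) - rFourHyp (n + 2)) = 0 := by
      linear_combination h1 - h2
    exact sub_eq_zero.mp ((mul_eq_zero.mp h3).resolve_left hP)

end Literature.NumberTheory.Irrationality.KrattenthalerZudilin2019
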